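import Summits.BirchSwinnertonDyer.Rank1Residual.ManinAdditive.ConwayKodairaLaws
import HarnessLib
import HarnessLib.Audit.Tags

/-!
# The JUMP–DEGREE mechanism at a tame additive prime: rows E-desc-106 / 107 / 109 / 110 typed (desc g16, MEMO-desc §34; T-desc-24; typer g17)
# (cell `bsd-f2-manin`, D-0131 (3) frontier: the Manin constant at additive primes)

TYPER NOTE.  SOURCE = HOME/desc/g16/Sketch-desc-g16.lean sha16 e4ab46701a7189ed (220 l.; farm rc 0 · 0 err · 0 warn · 0 sorry per desc,
check-g16.json), landed VERBATIM as a sibling leaf of `ConwayKodairaLaws.lean` except: (i) this note; (ii) namespace `…ManinAdditive.DescG16`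
folded to `…ManinAdditive.JumpDegree`; (iii) two elementary lemmas received one-line docstrings; (iv) two cite locators completed from the
materialised sources (Edixhoven, Compositio 81 (1992) Thm. 5.3 = bib key `Edixhoven1992NeronModelsTame` — the sketch's key `Edixhoven1992`
is the Inventiones «weight in Serre's conjectures» paper; Edixhoven, Ann. Inst. Fourier 40 (1990) Thm. 2.1.2).  Four `@[conjecture]` rows (nothing
asserted), three E-blind level predicates (definitions), five PROVED lemmas.  BC5: HOME/desc/g16/out-allcurves-check-500000.txt 1d3214c97f816203
(all Cremona curves `N < 5·10⁵`, optimal + non-optimal): E-desc-107 74 711 + 38 146 IV* curves even / 0 exceptions; E-desc-109 50 731 + 26 684 / 0;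
E-desc-110 191 937 + 41 996 / 0; E-desc-106 55/55 both ways (P-g16-census.md 1bf1b1b577af65de).  REFUTER VERDICTS: R-desc-24 (ref1) PENDING at
filing — repairs land under NEW names (append-only rule).  bears_on: stmt-BirchSwinnertonDyer-22967 (C2; §34.4 reformulation of `ord₂ c_E = 0`).

HONEST FRAMING.  LENS = descent / Néron models under additive base change (planner `bsd-f2-manin-desc`, g16; HOME
`run/shared/lean/pub/bsd-f2-manin/MEMO-desc.md` §34; censuses HOME/desc/g16/P-g16-census.md 1bf1b1b577af65de and
HOME/desc/g16/out-allcurves-check-500000.txt).  NOTHING is asserted: `@[conjecture] def … : Prop` rows + four kernel-checked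
elementary lemmas about the E-blind level predicates.  Namespace `…ManinAdditive.DescG16` (cell file; a landed copy would
live next to `ConwayKodairaLaws.lean`, whose preamble the rows copy VERBATIM: globally minimal `W`, a modular parametrisation
datum `D` at the conductor level, and — for the optimality-dependent row 106 only — the lattice clause + the minimal-degree
clause).

THE MECHANISM (MEMO-desc §34, THEOREM P; paper-level proof, inputs labelled there).  `4 ∥ N`, `M = N/4`, `K = ℚ₂^nr`,
`L = K(∛2)`.  Over `𝒪_L` the curve `X₀(N)` has a semistable model whose special fibre is: three copies of `X₀(M)_𝔽̄₂`, ONE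
supersingular elliptic curve `E_y` over each supersingular point `y` of `X₀(M)_𝔽̄₂` with `Aut(y) = {±1}` (there are
`n₁(M) = ψ(M)/12 − e₂(M)/4 − e₃(M)/3` of them) or `Aut(y) = ⟨i⟩` (`n₂(M) = e₂(M)/2` of them), chains of `ℙ¹`'s, and NOTHING of
positive genus over the `e₃(M)` points with `Aut(y) ∋ ρ`; `Gal(L/K) = μ₃` acts on `H⁰(E_y, Ω¹)` through `ζ` ↦ `ζ` at the
generic points and `ζ ↦ ζ²` at the `i`-points (anchors `X₀(36) = 36a1` (IV) and `X₀(20) = 20a1` (IV*)).  For a newform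
quotient `φ : X₀(N) → E` of conductor `N` (so IV or IV* at 2) the map extends to the model (Weil) and
**`deg φ = Σ_y deg(φ̄_y : E_y → Ē)`** (old components are contracted: the degeneracy matrix `[[1,F,F²],[F,1,F],[F²,F,1]]` has
determinant `(1 − F²)²`, an isogeny); `μ₃`-equivariance makes `φ̄_y` INSEPARABLE unless the character of `E_y` matches that of
`Ē` (IV ↔ generic, IV* ↔ `i`-points), so **`deg φ ≡ Σ_{y matching} deg φ̄_y (mod 2)`**.  At a level with a prime factor
`q ≡ 3 (mod 4)` there are no `i`-points (`e₂(M) = 0`), hence an IV* curve has EVEN modular degree: row **E-desc-107**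
(`74 711` optimal + `38 146` non-optimal IV* curves with `4 ∥ N < 5·10⁵` at such levels: all even, 0 exceptions; the 55
odd-degree IV* optimal curves all sit at `N = 4(s² + 4)`, `e₂ > 0`).  The same argument at any tame additive prime gives
«`jump_p(E) = v_p(Δ_min)/12` not a jump of `J₀(N)` at `p` ⇒ `p ∣ deg φ`»; the censuses (`9 ∥ N`, III*: `50 731 + 26 684`
curves, all `3 ∣ deg φ`; `p ≥ 5`, `p² ∥ N`, IV*/III*/II*: `191 937 + 41 996`, all `p ∣ deg φ`; `N < 5·10⁵`, optimal +
non-optimal, 0 exceptions) are rows **E-desc-109** (`p = 3`, tame, NO irreducibility binder — compare E-imc-10′) and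
**E-desc-110** (`p ≥ 5`, ALL parametrisations — E-imc-10 `StarredDegreeDivisibility` is its optimal-curve case), and they say
E-blindly that the jumps `2/3, 3/4, 5/6` do NOT occur in `J₀(N)` at a tame `p ≥ 3` (MEMO-desc §34 conjecture J♮), while at
`p = 2` THEOREM J (§34.2) computes the jump spectrum of `J₀(4M)` exactly: `0^{3g₀(M)+2(h−1)}, (1/3)^{n₁(M)}, (2/3)^{n₂(M)}`,
base-change conductor `c₂(J₀(4M)) = ψ(M)/36 + e₂(M)/4 − e₃(M)/9`.  Row **E-desc-106** is the optimality law in Kodaira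
currency (the cell's E-imc-29 / E-an-73 describe the same 55 classes in Manin-constant / blind-torsion currency): an
`X₀(N)`-optimal curve which is IV* at `2` on the tame cell and has a rational 2-torsion point lives at `N = 4(s² + 4)`,
`s² + 4` prime (55/55 classes, `N < 5·10⁵`; 0 optimal IV*-with-2-torsion classes elsewhere among 168 649).

IN PRINT / NOT (MEMO-desc §34.7, source-labelled): parity of `deg φ` — Calegari–Emerton 2009 Thm 1 (`E[2]` irreducible ⇒ even;
odd ⇒ rational 2-torsion at composite level), Yazdani 2011 Thm 2.15 / 3.8 (odd CONGRUENCE number, `N = 4p`), Stein–Watkins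
2002/2004 (prime level; the 2-isogeny families, text of 2002 §4 not held: acq-09831); the Kodaira-type side condition
`e₂(N/4) = 0`, the degree decomposition over the semistable fibre and the jump spectrum of `J₀(4M)` at 2: no hits (corpus
fts + hybrid, galaxy).  bears_on: stmt-BirchSwinnertonDyer-22967 (C2, Manin at 2 on `4 ∥ N`): §34.4 reformulates
`ord₂ c_E = 0` as «the `t`-order of `φ^*ω_{E/L}` on the semistable `𝒪_L`-model is at most `3·jump(E)`».
PARTITION 0 · beyond-print theorem: yes on paper (THEOREM P ⇒ E-desc-107; THEOREM J), no in Lean (statements only) ·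
BSD is not proved by this; Manin's conjecture is not proved by this.
-/

set_option autoImplicit false

noncomputable section

open scoped MatrixGroups ModularForm

open CongruenceSubgroup WeierstrassCurve Literature.NumberTheory.EllipticCurves.ModularForms
  Literature.NumberTheory.DiophantineGeometry
open Summit.BirchSwinnertonDyer.Rank1Residual.ManinAdditive.ConwayCut

namespace Summit.BirchSwinnertonDyer.Rank1Residual.ManinAdditive.JumpDegree

/-! ### §1. E-blind level predicates -/

/-- `e₂(N/4) = 0` in E-blind form: some prime `q ≡ 3 (mod 4)` divides `N` (for `4 ∥ N`: the supersingular locus of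
`X₀(N/4)` in characteristic 2 has NO point with automorphism `i`, so — THEOREM J — the jump `2/3` does not occur in `J₀(N)`
at `2`). -/
def HasPrimeFactorThreeModFour (N : ℕ) : Prop :=
  ∃ q : ℕ, q.Prime ∧ q ∣ N ∧ q % 4 = 3

/-- The complementary «Gaussian» levels: every odd prime factor of `N` is `≡ 1 (mod 4)` (`e₂(N/4) > 0` when `4 ∥ N`). -/
def AllOddPrimeFactorsOneModFour (N : ℕ) : Prop :=
  ∀ q : ℕ, q.Prime → q ∣ N → q ≠ 2 → q % 4 = 1

/-- The `s² + 4` levels: `N = 4p` with `p = s² + 4` prime (then `s` is odd and `p ≡ 5 (mod 8)`); the 55 such levels below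
`5·10⁵` are `20, 52, 116, 212, 692, 916, 1172, 2932, …, 343412`. -/
def IsFourSquarePlusFourLevel (N : ℕ) : Prop :=
  ∃ s : ℕ, (s ^ 2 + 4).Prime ∧ N = 4 * (s ^ 2 + 4)

/-- `¬ HasPrimeFactorThreeModFour N ↔ AllOddPrimeFactorsOneModFour N` (an odd prime is `1` or `3 (mod 4)`). -/
theorem not_hasPrimeFactorThreeModFour_iff (N : ℕ) :
    ¬ HasPrimeFactorThreeModFour N ↔ AllOddPrimeFactorsOneModFour N := by
  constructor
  · intro h q hq hqN hq2
    rcases hq.eq_two_or_odd with h2 | hodd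
    · exact absurd h2 hq2
    · by_contra h1
      exact h ⟨q, hq, hqN, by omega⟩
  · rintro h ⟨q, hq, hqN, h3⟩
    have h1 := h q hq hqN (by rintro rfl; omega)
    omega

/-- The `s² + 4` levels are Gaussian: `N = 4p`, `p = s² + 4` prime ⇒ `s` odd and `p ≡ 1 (mod 4)`. -/
theorem allOddPrimeFactorsOneModFour_of_isFourSquarePlusFourLevel {N : ℕ}
    (hN : IsFourSquarePlusFourLevel N) : AllOddPrimeFactorsOneModFour N := by
  obtain ⟨s, hp, rfl⟩ := hN
  intro q hq hqN hq2
  -- `q ∣ 4 * p` with `q ≠ 2` prime forces `q = p`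
  have hq4 : ¬ q ∣ 4 := by
    intro h4
    have h22 : q ∣ 2 * 2 := by simpa using h4
    rcases (Nat.Prime.dvd_mul hq).mp h22 with h | h <;>
      exact hq2 ((Nat.prime_dvd_prime_iff_eq hq Nat.prime_two).mp h)
  have hqp : q ∣ s ^ 2 + 4 := by
    rcases (Nat.Prime.dvd_mul hq).mp hqN with h | h
    · exact absurd h hq4
    · exact h
  have hqeq : q = s ^ 2 + 4 := (Nat.prime_dvd_prime_iff_eq hq hp).mp hqp
  subst hqeq
  -- `s` is odd, else `s² + 4` is even and prime, i.e. `= 2`, impossible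
  rcases Nat.even_or_odd s with ⟨t, ht⟩ | ⟨k, hk⟩
  · exfalso
    have hev : Even (s ^ 2 + 4) := ⟨2 * t ^ 2 + 2, by subst ht; ring⟩
    have h2 : s ^ 2 + 4 = 2 := (Nat.Prime.even_iff hp).mp hev
    omega
  · subst hk
    have : (2 * k + 1) ^ 2 + 4 = 4 * (k ^ 2 + k + 1) + 1 := by ring
    omega

/-- `N = 20 = 4·(1² + 4)` (the class of `X₀(20) = 20a1`, IV* at 2, `deg φ = 1`). -/
theorem isFourSquarePlusFourLevel_twenty : IsFourSquarePlusFourLevel 20 :=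
  ⟨1, by norm_num, by norm_num⟩

/-- `N = 44 = 4·11`: a level with a prime factor `≡ 3 (mod 4)` (44a1 is IV* at 2 with `deg φ = 2`, the smallest instance
of row E-desc-107). -/
theorem hasPrimeFactorThreeModFour_fortyfour : HasPrimeFactorThreeModFour 44 :=
  ⟨11, by norm_num, by norm_num, by norm_num⟩

/-! ### §2. The rows -/

/-- **Row E-desc-107 `FourStarEvenDegreeLaw` (THEOREM-CANDIDATE; cell bsd-f2-manin, desc g16, MEMO-desc §34.3; nothing
asserted).**  Every modular parametrisation `X₀(N) → E` at the conductor level of a curve with `4 ∥ N`, Kodaira type IV* at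
`2` (`v₂(Δ_min) = 8` on the tame cell) and a prime factor `q ≡ 3 (mod 4)` of `N` has EVEN degree.  Paper proof: THEOREM P
(degree decomposition over the semistable `ℤ₂^nr[∛2]`-model of `X₀(N)` + `μ₃`-equivariant inseparability) + THEOREM J (no
`i`-points when `e₂(N/4) = 0`), anchors `X₀(36)`, `X₀(20)`.  Census (BC5-style): 74 711 optimal + 38 146 non-optimal IV*
curves, `N < 5·10⁵`, all even, 0 exceptions; the side condition is necessary (55 odd-degree optimal IV* curves at
`N = 4(s² + 4)`, and odd-degree non-optimal IV* curves such as 20a3, `deg = 3`).  Why it might fail: only through an error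
in the anchor transport (locality of the semistable model at an `i`-point) — the statement itself has no exception below
`5·10⁵`.  In print: the sub-case `E[2]` irreducible is Calegari–Emerton 2009 Thm 1; the case with a rational 2-isogeny at
composite `N/4 ∈ {p^a (a ≥ 2), p^a q^b}` is not.
[cite: CalegariEmerton2009, Thm. 1 (arXiv:math/0503359 p. 2: the E[2]-irreducible sub-case; the Kodaira/level form and its proof are the cell's row E-desc-107 — MEMO-desc §34, NOT in print)]
[cite: Edixhoven1992NeronModelsTame, Thm. 5.3 (p. 300: the filtration on the special fibre of the Néron model after a tame totally ramified base change — the jumps; used in THEOREM J only, shape)] -/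
@[conjecture]
def FourStarEvenDegreeLaw : Prop :=
  ∀ (W : WeierstrassCurve ℚ) [W.IsElliptic] [W.IsGloballyMinimal] [NeZero (W.conductorNorm ℤ)]
    (D : ModularParametrizationData W (W.conductorNorm ℤ)),
    IsTypeFourStarAtTwoTame W → HasPrimeFactorThreeModFour (W.conductorNorm ℤ) → 2 ∣ D.modularDegree

/-- **Row E-desc-109 `ThreeStarDegreeLawTame` (LAW with mechanism; desc g16, MEMO-desc §34.5; nothing asserted).**  Every
modular parametrisation at the conductor level of a curve with `9 ∥ N` and Kodaira type III* at `3` (tame cell: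
`v₃(Δ_min) = 9` and potentially good, `v₃(j) ≥ 0`) has degree divisible by `3`.  = «the jump `3/4` does not occur in
`J₀(N)` at `3` for `9 ∥ N`» (conjecture J♮ at `p = 3`) + THEOREM P.  Census: 50 731 optimal + 26 684 non-optimal III*
curves, `N < 5·10⁵`, 0 exceptions (1 425 optimal ones at levels with `e₃(N/9) > 0`, one with a rational 3-isogeny); the
`I₃*` curves (`v₃Δ = 9`, `v₃ j = −3`) are excluded on purpose (90c1, `deg φ = 16`).  Compare E-imc-10′ (`p = 3`, all
`9 ∣ N`, WITH the binder `E[3]` irreducible, needed at `27 ∣ N` by 27a1): here no binder, tame cell only.  Why it might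
fail: a III* optimal curve at a level `9M`, all primes of `M` `≡ 1 (mod 3)`, where a wild (`C₃`-stabiliser) supersingular
point of `X₀(M)_𝔽̄₃` produces the jump `3/4` after all — the `p = 3` analogue of the `s² + 4` family; none below `5·10⁵`.
[cite: CalegariEmerton2009, Thm. 1 (shape only: parity-type divisibility of the modular degree from local structure at an additive prime; the p = 3 tame row is the cell's E-desc-109 — MEMO-desc §34, NOT in print)] -/
@[conjecture]
def ThreeStarDegreeLawTame : Prop :=
  ∀ (W : WeierstrassCurve ℚ) [W.IsElliptic] [W.IsGloballyMinimal] [NeZero (W.conductorNorm ℤ)]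
    (D : ModularParametrizationData W (W.conductorNorm ℤ)),
    padicValNat 3 (W.conductorNorm ℤ) = 2 → padicValRat 3 W.Δ = 9 → 0 ≤ padicValRat 3 W.j →
      3 ∣ D.modularDegree

/-- **Row E-desc-110 `StarredDegreeLawAllParametrisations p` (LAW with mechanism, `p ≥ 5`; desc g16, MEMO-desc §34.5;
nothing asserted).**  Every modular parametrisation at the conductor level of a curve with `p² ∥ N`, potentially good
reduction at `p` and a STARRED type there (`v_p(Δ_min) ∈ {8, 9, 10}` = IV*, III*, II*, i.e. jump `2/3, 3/4, 5/6`) has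
degree divisible by `p` — for EVERY curve in the isogeny class, not only the optimal one (the cell's E-imc-10
`StarredDegreeDivisibility p` is the optimal-curve case, 0 / 191 937).  = conjecture J♮ («no jump `> 1/2` in `J₀(N)` at a
tame `p ≥ 5`») + THEOREM P.  Census: 191 937 optimal + 41 996 non-optimal starred incidences, `N < 5·10⁵`, 0 exceptions;
controls: jumps `1/6, 1/4, 1/3, 1/2` have `p ∤ deg φ` in 25–40 % of the cases (`N < 1.3·10⁵`: 16 394 / 11 745 / 7 858 /
15 501 against).  Why it might fail: a level `p²M` at which an exceptional curve of the stable reduction of `X₀(p²M)`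
(Edixhoven 1990: the curves over `j = 0, 1728` when `p ≡ 2 (3)`, `3 (4)`) carries the inertia character of a starred type.
[cite: Edixhoven1990, Thm. 2.1.2 (p. 55: stable reduction of M(P,[Γ₀(p²)]) for p > 5 over W[ζ][X]/(X^((p²−1)/2) − p) — the components; the inertia characters on their differentials = conjecture J♮ are NOT computed there as far as the cell knows, X-desc-5)]
[cite: Watkins2002, §2.1 (shape only, as for E-imc-10)] -/
@[conjecture]
def StarredDegreeLawAllParametrisations (p : ℕ) : Prop :=
  ∀ (W : WeierstrassCurve ℚ) [W.IsElliptic] [W.IsGloballyMinimal] [NeZero (W.conductorNorm ℤ)]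
    (D : ModularParametrizationData W (W.conductorNorm ℤ)),
    p.Prime → 5 ≤ p → padicValNat p (W.conductorNorm ℤ) = 2 → 0 ≤ padicValRat p W.j →
    (padicValRat p W.Δ = 8 ∨ padicValRat p W.Δ = 9 ∨ padicValRat p W.Δ = 10) →
      p ∣ D.modularDegree

/-- **Row E-desc-106 `OptimalFourStarTwoTorsionLaw` (LAW; desc g16, MEMO-desc §34.6; nothing asserted; the Kodaira-type
currency of the cell's E-imc-29 / E-an-73, same 55 classes).**  An `X₀(N)`-optimal curve (lattice clause + minimal-degree
clause, as in `ConwayKodairaLaws`) which is IV* at `2` on the tame cell `4 ∥ N` and has a rational 2-torsion point lives at a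
level `N = 4(s² + 4)` with `s² + 4` prime.  Census: among the 168 649 optimal curves with `4 ∥ N < 5·10⁵` exactly 55 are
IV* with a rational 2-torsion point, all at the 55 levels `4(s² + 4)` in range (55/55 both ways); equivalently: in each of
the 30 915 isogeny classes with a rational 2-torsion point (every one contains both IV and IV* curves) the optimal curve is
a IV curve, except in the `s² + 4` family where it is the IV* curve `y² = x³ − 2s x² + (s² + 4) x` of odd degree.  Why it
might fail: a Gaussian level (`e₂(N/4) > 0`, so the jump `2/3` IS available in `J₀(N)`) carrying a IV* optimal curve with
2-torsion and even degree — THEOREM P allows it; what forbids it is global (Shimura subgroup / Eisenstein at 2, the imc and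
an lenses), not local.
[cite: Yazdani2011, Thm. 3.8 (4) and §3.5 (arXiv:0910.0571 p. 15: N = 4p with odd congruence number ⇒ p = s² + 4; the Kodaira/optimality law is the cell's E-desc-106, its Manin-constant form E-imc-29 — NOT in print)]
[cite: AgasheRibetStein2006, §5 p. 18 (the 13 classes in (60000, 130000) whose optimal curve is not the minimal-height curve: eight of them are these levels)] -/
@[conjecture]
def OptimalFourStarTwoTorsionLaw : Prop :=
  ∀ (W : WeierstrassCurve ℚ) [W.IsElliptic] [W.IsGloballyMinimal] [NeZero (W.conductorNorm ℤ)]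
    (D : ModularParametrizationData W (W.conductorNorm ℤ)),
    (∀ z ∈ D.L.lattice, ∃ w ∈ periodLattice D.f, z = D.c * w) →
    (∀ (W' : WeierstrassCurve ℚ) [W'.IsElliptic]
        (D' : ModularParametrizationData W' (W.conductorNorm ℤ)),
        D'.f = D.f → D.modularDegree ≤ D'.modularDegree) →
    IsTypeFourStarAtTwoTame W → HasRationalTwoTorsion W → IsFourSquarePlusFourLevel (W.conductorNorm ℤ)

/-- E-desc-106 puts the optimal IV*-with-2-torsion curves on Gaussian levels (proved from the two defs). -/
theorem allOddPrimeFactors_of_optimalFourStarTwoTorsionLaw (h : OptimalFourStarTwoTorsionLaw)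
    (W : WeierstrassCurve ℚ) [W.IsElliptic] [W.IsGloballyMinimal] [NeZero (W.conductorNorm ℤ)]
    (D : ModularParametrizationData W (W.conductorNorm ℤ))
    (hΛ : ∀ z ∈ D.L.lattice, ∃ w ∈ periodLattice D.f, z = D.c * w)
    (hmin : ∀ (W' : WeierstrassCurve ℚ) [W'.IsElliptic]
        (D' : ModularParametrizationData W' (W.conductorNorm ℤ)),
        D'.f = D.f → D.modularDegree ≤ D'.modularDegree)
    (hIV : IsTypeFourStarAtTwoTame W) (hT : HasRationalTwoTorsion W) :
    ¬ HasPrimeFactorThreeModFour (W.conductorNorm ℤ) :=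
  (not_hasPrimeFactorThreeModFour_iff _).mpr
    (allOddPrimeFactorsOneModFour_of_isFourSquarePlusFourLevel (h W D hΛ hmin hIV hT))

end Summit.BirchSwinnertonDyer.Rank1Residual.ManinAdditive.JumpDegree

end
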